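import Summits.BirchSwinnertonDyer.BirchSwinnertonDyer.Theorems.KolyvaginRankRigidityAtTwoKolyvaginCorankLowerBoundAtTwoMarginLocalOrderLevelUpAtTwo
import Summits.BirchSwinnertonDyer.BirchSwinnertonDyer.Theorems.KolyvaginRankRigidityAtTwoOffHabitatIrredRingClassNoTwoTorsion
import HarnessLib

/-!
# Route `KolyvaginRankRigidityAtTwo`, residual crux R_irr `OffHabitatIrredNonSurjTwoConverse`
# (stmt-BirchSwinnertonDyer-27123, LINE 8∞): S4 «LOCAL ORDERS GO UP WITH THE LEVEL» OFF THE HABITAT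
# (helper, PROVED, unconditional; width seat `bsd-line-krr2-p2` g9)

The habitat stub S4 `stub_localOrderLevelUpAtTwo` (`…MarginLocalOrderLevelUpAtTwo`: `ι_* c_M(n) = 2^s c_{M+s}(n)`
and local vanishing at a Zhang–Kolyvagin prime of index `≥ M + s` is `ι_*`-invariant) uses the `2`-adic image only
through the `hA` binder at the two levels (`KolyvaginRankRigidity.isAdmissible_pointsSubgroup_two … hs`, `hs = ρ̄_{E,2}`
onto). With the off-habitat `hA` (`…_offHabitat`, from `E(ℚ)[2] = 0`, p649334) the same statement holds on the
frame of R_irr: `localOrderLevelUpAtTwo_offHabitat` — the plug-in replacement of S4 for the re-threading of S1L /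
V2irr / U2irr (LINE 8∞).

HONEST FRAMING: helper (`--supports` 27123); nothing here closes R_irr; BSD is NOT proved by any of this.

References: [McCallumLMS1991] §3 (3), §4 (5); [GrossLMS1991] §4 (4.2), Lemma 4.3; [WZhang2014] Notations (xii).
-/

set_option autoImplicit false
-- the Theorems namespace of this sub repeats the summit name by design (D-0017 nested layout)
set_option linter.dupNamespace false

noncomputable section

open scoped Classical NumberField

namespace Summit.BirchSwinnertonDyer.BirchSwinnertonDyer.Theorems.KolyvaginLowerBoundAtTwo

open WeierstrassCurve Field NumberField IsDedekindDomain
open Literature.NumberTheory.GaloisRepresentations Literature.NumberTheory.EllipticCurves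
  Literature.NumberTheory.EllipticCurves.ModularForms Literature.NumberTheory.EllipticCurves.KolyvaginCocycle
open Summit.BirchSwinnertonDyer.Rank1Residual.X11b.Three

set_option maxHeartbeats 800000 in
/-- **S4 `stub_localOrderLevelUpAtTwo` OFF THE HABITAT: local orders of Kolyvagin classes at a fresh Kolyvagin
prime go up with the level** — the habitat stub's text with the binder `(∀ m, ρ̄_{E,2^m} onto)` replaced by
`E(ℚ)[2] = 0`; the habitat proof verbatim with the admissibility at both levels from
`KolyvaginRankRigidity.isAdmissible_pointsSubgroup_two_offHabitat` (p649334). [cite: McCallumLMS1991, §3 (3), §4 (5)]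
[cite: GrossLMS1991, §4 (4.2), Lemma 4.3] [cite: WZhang2014, Notations (xii)] -/
theorem localOrderLevelUpAtTwo_offHabitat : ∀ (W : WeierstrassCurve ℚ) [W.IsElliptic] [W.IsGloballyMinimal], ¬ W.HasCM → (Rank1Residual.GoodOrd W 2 ∨ Rank1Residual.Mult W 2) → AddSubgroup.torsionBy W.toAffine.Point (2 : ℤ) = ⊥ → ∀ (K : Type) [Field K] [NumberField K], IsImaginaryQuadratic K → NumberField.discr K ≠ -3 → NumberField.discr K ≠ -4 → ¬ ((2 : ℤ) ∣ NumberField.discr K) → ∀ [NeZero (W.conductorNorm ℤ)], SatisfiesHeegnerHypothesis (W.conductorNorm ℤ) K → ∀ (Dt : ModularParametrizationData W (W.conductorNorm ℤ)) (β : ℤ) (ι : K →+* ℂ), ∀ (n : ℕ) (dat : KolyvaginHeegnerData Dt β ι n) (M M' j q : ℕ) (v : HeightOneSpectrum (𝓞 K)), KolyvaginDescent.KolSupp (Zhang2014.IsKolyvaginPrime (W.conductorNorm ℤ) W K 2) n → 1 ≤ M → M ≤ M' → (M' : ℕ∞) ≤ Zhang2014.levelIndex W 2 n → Zhang2014.IsKolyvaginPrime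 (W.conductorNorm ℤ) W K 2 q → M' ≤ Zhang2014.kolyvaginIndex W 2 q → ¬ q ∣ n → ((q : ℕ) : 𝓞 K) ∈ v.asIdeal → ((2 ^ j : ℕ) : ℤ) • dat.kolyvaginClass Nat.prime_two M ∉ (W.baseChange K).torsionLocalKer (v.adicCompletion K) ((2 ^ M : ℕ) : ℤ) → ((2 ^ (j + (M' - M)) : ℕ) : ℤ) • dat.kolyvaginClass Nat.prime_two M' ∉ (W.baseChange K).torsionLocalKer (v.adicCompletion K) ((2 ^ M' : ℕ) : ℤ) := by
  intro W _ _ hCM hred htorQ K _ _ hK hne3 hne4 h2d _ hHN Dt β ι n dat M M' j q v hn hM1 hMM' hlev' hq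
    hqidx hqn hv hloc
  classical
  haveI : Fact (Nat.Prime 2) := ⟨Nat.prime_two⟩
  haveI : (W.baseChange K).IsElliptic := by rw [baseChange]; infer_instance
  obtain ⟨s, rfl⟩ : ∃ s, M' = M + s := ⟨M' - M, by omega⟩
  -- ### standing inputs of McCallum's class at both levels (habitat)
  have hn0 : n ≠ 0 := hn.1.ne_zero
  have h2n : ¬ 2 ∣ n := fun h2 ↦
    (hn.2 2 (Nat.mem_primeFactors.mpr ⟨Nat.prime_two, h2, hn0⟩)).2.2.2.1 rfl
  have hcop : Nat.Coprime (W.conductorNorm ℤ) n :=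
    Nat.coprime_of_dvd fun k hk hkN hkn ↦
      (hn.2 k (Nat.mem_primeFactors.mpr ⟨hk, hkn, hn0⟩)).2.1 hkN
  have hA : ∀ L : ℕ, IsAdmissible (absoluteGaloisGroup K) dat.pointsSubgroup ((2 ^ L : ℕ) : ℤ) :=
    fun L ↦ KolyvaginRankRigidity.isAdmissible_pointsSubgroup_two_offHabitat dat htorQ hK h2d hHN hn0 h2n hcop L
  have hD : NumberField.discr K < -4 := by
    have hneg : NumberField.discr K < 0 := hK.discr_neg
    have h2 : 2 < |NumberField.discr K| :=
      NumberField.abs_discr_gt_two (by rw [hK.1]; exact one_lt_two)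
    rw [abs_of_neg hneg] at h2
    have hodd : Odd (NumberField.discr K) := by
      rcases Int.even_or_odd (NumberField.discr K) with h | h
      · exact absurd (even_iff_two_dvd.mp h) h2d
      · exact h
    obtain ⟨k, hk⟩ := hodd
    omega
  have hP : ∀ L : ℕ, (L : ℕ∞) ≤ Zhang2014.levelIndex W 2 n →
      dat.toGeomPoints dat.derivedPoint ∈
        invPoints (absoluteGaloisGroup K) dat.pointsSubgroup ((2 ^ L : ℕ) : ℤ) := fun L hL ↦
    Theorems.Prop44.toGeomPoints_derivedPoint_mem_invPoints hK ι hD hHN Dt Nat.prime_two hn.1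
      (fun q hq ↦ ⟨hn.2 q hq, (Zhang2014.natCast_le_levelIndex_iff.mp hL) q hq⟩) dat
  have hlevM : (M : ℕ∞) ≤ Zhang2014.levelIndex W 2 n := le_trans (by exact_mod_cast hMM') hlev'
  have hκ₁ := dat.kolyvaginClass_of_admissible Nat.prime_two M (hA M) (hP M hlevM)
  have hκ₂ := dat.kolyvaginClass_of_admissible Nat.prime_two (M + s) (hA (M + s)) (hP (M + s) hlev')
  -- ### `ι_* c_M(n) = 2^s · c_{M+s}(n)`
  have hdvdN : 2 ^ M ∣ 2 ^ (M + s) := pow_dvd_pow 2 (Nat.le_add_right M s)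
  have hdvdZ : ((2 ^ M : ℕ) : ℤ) ∣ ((2 ^ (M + s) : ℕ) : ℤ) := Int.natCast_dvd_natCast.mpr hdvdN
  have hnm : ((2 ^ (M + s) : ℕ) : ℤ) = ((2 ^ s : ℕ) : ℤ) * ((2 ^ M : ℕ) : ℤ) := by
    push_cast; ring
  have hPQ : ((2 ^ s : ℕ) : ℤ) • dat.toGeomPoints dat.derivedPoint =
      ((2 ^ s : ℕ) : ℤ) • dat.toGeomPoints dat.derivedPoint +
        ((2 ^ (M + s) : ℕ) : ℤ) • (0 : geomPoints (W.baseChange K)) := by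
    rw [smul_zero, add_zero]
  have hP' : ((2 ^ s : ℕ) : ℤ) • dat.toGeomPoints dat.derivedPoint +
        ((2 ^ (M + s) : ℕ) : ℤ) • (0 : geomPoints (W.baseChange K)) ∈
      invPoints (absoluteGaloisGroup K) dat.pointsSubgroup ((2 ^ (M + s) : ℕ) : ℤ) := by
    rw [smul_zero, add_zero]; exact (invPoints _ _ _).zsmul_mem (hP (M + s) hlev') _
  have hι := Koly.torsionH1OfDvd_kolyvaginClass_of_zsmul (W.baseChange K) hdvdZ hnm
    ((W.baseChange K).zsmul_geomPoints_surjective_of_charZero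
      (by exact_mod_cast pow_ne_zero M Nat.prime_two.ne_zero))
    ((W.baseChange K).zsmul_geomPoints_surjective_of_charZero
      (by exact_mod_cast pow_ne_zero (M + s) Nat.prime_two.ne_zero))
    (hA M) (hA (M + s)) (hP M hlevM) hPQ hP'
  have hlin := Summit.BirchSwinnertonDyer.BirchSwinnertonDyer.Theorems.kolyvaginClass_zsmul_add_zsmul_eq
    (hdiv := (W.baseChange K).zsmul_geomPoints_surjective_of_charZero
      (by exact_mod_cast pow_ne_zero (M + s) Nat.prime_two.ne_zero))
    (hA (M + s)) (hP (M + s) hlev') ((2 ^ s : ℕ) : ℤ) (dat.pointsSubgroup.zero_mem) hP'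
  rw [hlin, ← hκ₂, ← hκ₁] at hι
  -- `hι : ι_* (c_M(n)) = 2^s • c_{M+s}(n)`
  -- ### `Γ_{K_v}` fixes `E[2^{M+s}]` (Zhang–Kolyvagin prime of index `≥ M + s`)
  have htriv : ∀ (g : absoluteGaloisGroup (v.adicCompletion K))
      (Q : geomTorsion (W.baseChange K) ((2 ^ (M + s) : ℕ) : ℤ)),
      resGal (K := K) (v.adicCompletion K) g • Q = Q := fun g Q ↦ by
    rw [resGal_eq_absGaloisRestrict]
    have hd : absGaloisRestrict K (v.adicCompletion K) g ∈
        (adicCompletionPrime K v).decompositionSubgroup (absoluteGaloisGroup K) := by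
      rw [decompositionSubgroup_adicCompletionPrime_eq_range]; exact ⟨g, rfl⟩
    exact smul_eq_of_mem_torsionFixing _ _
      (Summit.BirchSwinnertonDyer.Rank1Residual.JET.GlobalDuality.decompositionSubgroup_le_torsionFixing
        W K hK hq hqidx v hv (adicCompletionPrime_mem_primesAbove K v) hd) Q
  -- ### local vanishing is invariant under `ι_*` at `v`
  have e := mem_torsionLocalKer_iff_torsionH1OfDvd_mem (W.baseChange K) (v.adicCompletion K) hdvdN
    (pow_ne_zero M Nat.prime_two.ne_zero) (pow_ne_zero (M + s) Nat.prime_two.ne_zero) htriv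
    (((2 ^ j : ℕ) : ℤ) • dat.kolyvaginClass Nat.prime_two M)
  intro hmem
  apply hloc
  rw [e, map_zsmul]
  have hι' : torsionH1OfDvd (W.baseChange K) (Int.natCast_dvd_natCast.mpr hdvdN)
      (dat.kolyvaginClass Nat.prime_two M) = ((2 ^ s : ℕ) : ℤ) • dat.kolyvaginClass Nat.prime_two (M + s) :=
    hι
  rw [hι', smul_smul, ← Nat.cast_mul, ← pow_add, show j + s = j + (M + s - M) by omega]
  exact hmem

end Summit.BirchSwinnertonDyer.BirchSwinnertonDyer.Theorems.KolyvaginLowerBoundAtTwo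

end
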